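import Summits.Ventures.HSemireg.WedgeHankelRecurrenceHankelDeterminant
import Mathlib.LinearAlgebra.Matrix.Charpoly.Minpoly

/-!
# Venture HSemireg — THE COMPANION MATRIX OF A CLASS: for `m` monic of degree `t + 1`, N73's multiplication matrix at `a = X`, **`M_X = mulResidueMat t m X`, IS THE COMPANION MATRIX OF `m`: its
# characteristic polynomial is `m`**, so `det M_X = (−1)^{t+1} m(0)`, `trace M_X = − [X^t] m`, and by Barnett's factorisation (N73) **the shifted Hankel determinant
# `det (charSeq m (i + j + 1))_{i,j ≤ t} = sign(reversal)·(−1)^{t+1}·m(0)`**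

HONEST FRAMING. Part of the Lean index of the computation cell `pub-hsemireg` (seat p10 gen 30, Sunday typer «UNIFORM-IN-n»).
LINEAR ALGEBRA OF HANKEL (catalecticant) MATRICES and of polynomials over a field ONLY (`Polynomial.modByMonic`, `AdjoinRoot`, `Matrix.charpoly`): no variety, no cohomology theory, no sheaf,
no Ext group and no semiregularity map is constructed here; nothing here says that HC / HC_CM / HC_AV holds; no Literature fact is declared or used.  Custodian versions as in
`WedgeHankelSiegelIdeal` (1/3); the dictionary («Frobenius companion matrix of `m` = multiplication by `x` on `K[X]/(m)` in the monomial basis») is QUOTED in docstrings, never asserted.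

WHAT IS IN THE TREE.  N73 (`WedgeHankelRecurrenceHankelDeterminant`, № 435): `mulResidueMat`, `reindex_leftMulMatrix_eq_mulResidueMat` (`M_a` = the matrix of multiplication by `mk a` in the power basis),
`det_hankelSq_dualSeq` (`det H(dualSeq m a) = sign(revPerm)·det M_a`); N32 (№ 263) `dualSeq_X_mul` (`dualSeq m (X·a) j = dualSeq m a (j + 1)`), `dualSeq_one` (`dualSeq m 1 = charSeq m`).  Mathlib:
`charpoly_leftMulMatrix` (`= minpoly`), `AdjoinRoot.powerBasis'`, `AdjoinRoot.minpoly_root`, `AdjoinRoot.mk_X`, `Matrix.charpoly_reindex`, `Matrix.det_eq_sign_charpoly_coeff`, `Matrix.trace_eq_neg_charpoly_coeff`.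
THIS FILE (namespace `Summit.Ventures.HSemireg.Wedge.HankelOuter` continued; PLAIN on N73 (+ `Mathlib.LinearAlgebra.Matrix.Charpoly.Minpoly`); 0 definitions):
* §639 **`charpoly_mulResidueMat_X`** (`(mulResidueMat t m X).charpoly = m`), **`det_mulResidueMat_X`** (`= (−1)^{t+1} · m.coeff 0`), `trace_mulResidueMat_X` (`= − m.coeff t`),
  `dualSeq_X_eq_charSeq_succ` (`dualSeq m X j = charSeq m (j + 1)`), **`det_hankelSq_charSeq_succ`** (`det (charSeq m (i + j + 1))_{i,j ≤ t} = sign(revPerm)·(−1)^{t+1}·m.coeff 0`).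
Nothing Ext-side.  New names only.
-/

open Module Polynomial
open scoped Matrix Polynomial

namespace Summit.Ventures.HSemireg.Wedge.HankelOuter

open Summit.Ventures.HSemireg.Wedge Summit.Ventures.HSemireg.Wedge.Hankel

variable (K : Type*) [Field K]

/-! ## §639. `M_X` is the companion matrix of `m` -/

/-- **THE CHARACTERISTIC POLYNOMIAL OF `M_X` IS `m`** (`m` monic of degree `t + 1`): `M_X` is the matrix of multiplication by `x = X mod m` in the power basis of `K[X]/(m)`, whose characteristic
polynomial is the minimal polynomial `m` of `x`. -/
theorem charpoly_mulResidueMat_X {t : ℕ} {m : K[X]} (hm : m.Monic) (hmd : m.natDegree = t + 1) : (mulResidueMat K t m Polynomial.X).charpoly = m := by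
  rw [← reindex_leftMulMatrix_eq_mulResidueMat K hm hmd Polynomial.X, Matrix.charpoly_reindex, AdjoinRoot.mk_X]
  have h := charpoly_leftMulMatrix (AdjoinRoot.powerBasis' hm)
  rw [show (AdjoinRoot.powerBasis' hm).gen = AdjoinRoot.root m from rfl, AdjoinRoot.minpoly_root hm.ne_zero, hm.leadingCoeff, inv_one, C_1, mul_one] at h
  exact h

/-- **`det M_X = (−1)^{t+1} · m(0)`.** -/
theorem det_mulResidueMat_X {t : ℕ} {m : K[X]} (hm : m.Monic) (hmd : m.natDegree = t + 1) : (mulResidueMat K t m Polynomial.X).det = (-1) ^ (t + 1) * m.coeff 0 := by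
  rw [Matrix.det_eq_sign_charpoly_coeff, charpoly_mulResidueMat_X K hm hmd, Fintype.card_fin]

/-- `trace M_X = − [X^t] m`. -/
theorem trace_mulResidueMat_X {t : ℕ} {m : K[X]} (hm : m.Monic) (hmd : m.natDegree = t + 1) : (mulResidueMat K t m Polynomial.X).trace = -m.coeff t := by
  rw [Matrix.trace_eq_neg_charpoly_coeff, charpoly_mulResidueMat_X K hm hmd, Fintype.card_fin, Nat.add_sub_cancel]

/-- `dualSeq m X j = charSeq m (j + 1)`: the dual class of `X` is the shifted characteristic class. -/
theorem dualSeq_X_eq_charSeq_succ (m : K[X]) (j : ℕ) : dualSeq K m Polynomial.X j = charSeq K m (j + 1) := by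
  rw [← mul_one Polynomial.X, dualSeq_X_mul, dualSeq_one]

/-- **THE SHIFTED HANKEL DETERMINANT OF THE CHARACTERISTIC CLASS: `det (charSeq m (i + j + 1))_{i,j ≤ t} = sign(reversal) · (−1)^{t+1} · m.coeff 0`** (`m` monic of degree `t + 1`; Barnett's
factorisation N73 at `a = X` and the companion determinant). -/
theorem det_hankelSq_charSeq_succ {t : ℕ} {m : K[X]} (hm : m.Monic) (hmd : m.natDegree = t + 1) :
    (hankelSq K t (fun j => charSeq K m (j + 1))).det = Equiv.Perm.sign (Fin.revPerm : Equiv.Perm (Fin (t + 1))) * ((-1) ^ (t + 1) * m.coeff 0) := by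
  have h : (fun j => charSeq K m (j + 1)) = dualSeq K m Polynomial.X := funext fun j => (dualSeq_X_eq_charSeq_succ K m j).symm
  rw [h, det_hankelSq_dualSeq K hm hmd, det_mulResidueMat_X K hm hmd]

end Summit.Ventures.HSemireg.Wedge.HankelOuter
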